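import Summits.Ventures.GridStability.Lyapunov.WSCC9LossySlab
import Summits.Ventures.GridStability.Lyapunov.StructurePreservingLevelBound
import Summits.Ventures.GridStability.Models.StructurePreservingSlabWindow
import HarnessLib

/-!
# GridStability/Lyapunov/WSCC9LossySlabRoa — #35 «G2.c-WSCC9-LOSSY-SLAB» (lane V): the sector hypothesis
# by EXACT rational tests, the rank-one level, and THE SENTENCE for every solution of the printed-lossy
# WSCC9 classical model

Venture GRIDFUSION, lead RULING R-LOSSY-SLAB-ROW + AMENDMENT 1 «same M′, two presentations» + 07:15:04Z
(lane V PRIMARY: γ = 2·arctan(13/200) ≈ 7.44°, rank-one level); seat gridfusion-lyap-1 (g4). Inputs: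
`WSCC9LossySlab.lean` (`cert : SlabCertificate WSCC9.lurieSystem`, `rankOne`, `s_pos`), the Psd facts
(`level_test`, `gammaLo_test`), model-1's bridge `WSCC9.hasDerivWithinAt_lurieState` and channel algebra
(`dirMarginB_cast`, `dirSinB_cast`, `Ypol_sq_cast`, `postB_SPdamp_channelShift_abs_lt`), model-2's
half-angle lemmas (`cos_two_mul_arctan`, `sin_two_mul_arctan`, `lt_two_arctan_of_sq_le`), lit-6's
`cos_bounds_of_slab` and `SlabCertificate.well_subset_regionOfAttraction_of_rankOne`.

THE SECTOR HYPOTHESIS WITHOUT BRACKETS (`sector_of_tests`): for a channel with `Y cos δ* = m`,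
`Y sin δ* = n` (`Y = √(B² + G²)`; `m = B·cd − G·sd`, `n = B·sd + G·cd` RATIONAL under the A1 circle
points) and `cos γ = c_γ`, `sin γ = s_γ` rational (`γ = 2·arctan u`): `a ≤ cos ξ ≤ b` on `|ξ − δ*| ≤ γ`
follows from the decidable tests `a²Y² ≤ (m c_γ − |n| s_γ)²` (with both sides' bases `≥ 0`) and either
`b ≥ 1` or (`m² ≤ c_γ² Y²` and `(m c_γ + |n| s_γ)² ≤ b² Y²`) — `channel_tests`, ONE `decide` over `ℚ`.

THREE COLUMNS. CERTIFIED (kernel): for the MODEL M′ = WSCC9-postB-SPdamp-h12 in Pai's DIRECTED Lur'e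
presentation `WSCC9.lurieSystem` (post-fault-B reduction WITH transfer conductances, printed damping
`D/M = 1/10, 1/5, 3/10`; equilibrium = the A1 circle points), the slab + Popov class
`C′ = SlabCertificate` (S-procedure on the window `|σ_k − δ*_k| < γ = 2·arctan(13/200)` of all nine
directed channels, Popov multipliers on the six active ones) is NOT EMPTY — `WSCC9LossySlab.cert` — and
certifies: every solution of the classical model whose Lur'e state starts in the slab with
`V ≤ c = 176462957398167/222684717500000000` keeps the slab and the level for all `t ≥ 0` and has Lur'e
state `→ 0` (all speed deviations `→ 0`, relative rotor angles `→` their post-fault equilibrium values).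
Printed BESIDE #24 (`WSCC9LurieObstruction.lean`): on the SAME object the Popov-free quadratic class is
EMPTY. VALIDATED: sos-2's feasibility window 7.44°–7.78° and three solver lineages; the inner-ball radius
1.67° is a VALIDATED reading of `c`, not a kernel fact. MODELLED: classical model, as-printed lossy h12
reduction, printed non-uniform damping (MV-2 + MV-P + MV-SPD + MV-h12); the window / η / slab are CLASS
data. No sentence of this file says a grid is stable.
-/

noncomputable section

open Real Set Filter Matrix
open scoped Topology
open Literature.MathematicalPhysics.PowerSystems
open Literature.MathematicalPhysics.PowerSystems.LyapunovFunctionFamily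
open Literature.Computation.Certificates
open Summit.Ventures.GridStability.Models
open Summit.Ventures.GridStability.Lyapunov.LurieObstruction

namespace Summit.Ventures.GridStability.Lyapunov.WSCC9LossySlab

/-! ### The slab half-width `γ = 2·arctan(13/200)` -/

/-- The slab half-width `γ = 2·arctan u`, `u = 13/200` (≈ 7.44°). -/
def γ : ℝ := 2 * Real.arctan ((uQ : ℚ) : ℝ)

/-- `cos γ = c_γ` (rational). -/
theorem cos_γ : Real.cos γ = ((cgQ : ℚ) : ℝ) := by
  unfold γ
  rw [Lyapunov.StructurePreserving.cos_two_mul_arctan, cgQ_sgQ.1]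
  push_cast
  ring

/-- `sin γ = s_γ` (rational). -/
theorem sin_γ : Real.sin γ = ((sgQ : ℚ) : ℝ) := by
  unfold γ
  rw [Lyapunov.StructurePreserving.sin_two_mul_arctan, cgQ_sgQ.2]
  push_cast
  ring

/-- `0 ≤ γ ≤ π/2`. -/
theorem γ_range : 0 ≤ γ ∧ γ ≤ π / 2 := by
  have hu : (0 : ℝ) ≤ ((uQ : ℚ) : ℝ) := by exact_mod_cast uQ_pos_le.1.le
  have hu1 : ((uQ : ℚ) : ℝ) < 1 := by
    have : uQ < 1 := by norm_num [uQ]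
    exact_mod_cast this
  exact ⟨Lyapunov.StructurePreserving.two_mul_arctan_nonneg hu,
    (Lyapunov.StructurePreserving.two_mul_arctan_lt_pi_div_two hu1).le⟩

/-- `γ_lo < γ` (the rational `γ_lo = 64863/500000` passes `γ_lo²(1 + u²) ≤ 4u²`). -/
theorem gammaLo_lt_γ : ((gammaLoQ : ℚ) : ℝ) < γ := by
  have h := gammaLo_test
  have h0 : (0 : ℝ) ≤ ((gammaLoQ : ℚ) : ℝ) := by exact_mod_cast h.1
  have hu : (0 : ℝ) < ((uQ : ℚ) : ℝ) := by exact_mod_cast uQ_pos_le.1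
  have h2 : ((gammaLoQ : ℚ) : ℝ) ^ 2 * (1 + ((uQ : ℚ) : ℝ) ^ 2) ≤ 4 * ((uQ : ℚ) : ℝ) ^ 2 := by
    exact_mod_cast h.2
  exact StructurePreserving.lt_two_arctan_of_sq_le hu h0 h2

/-! ### The sector lemma from rational tests -/

/-- `sin |x| = |sin x|` for `|x| ≤ π`. [folklore] -/
theorem sin_abs_eq_abs_sin {x : ℝ} (hx : |x| ≤ π) : Real.sin |x| = |Real.sin x| := by
  rcases le_or_gt 0 x with h | h
  · rw [abs_of_nonneg h, abs_of_nonneg (Real.sin_nonneg_of_nonneg_of_le_pi h (by rwa [abs_of_nonneg h] at hx))]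
  · have hx' : -π ≤ x := by rw [abs_of_neg h] at hx; linarith
    have hsn : Real.sin x ≤ 0 := by
      have := Real.sin_nonneg_of_nonneg_of_le_pi (x := -x) (by linarith) (by linarith)
      rw [Real.sin_neg] at this
      linarith
    rw [abs_of_neg h, Real.sin_neg, abs_of_nonpos hsn]

/-- **Sector bounds of one channel from decidable tests.** With `Y > 0`, `Y cos δ = m`, `Y sin δ = n`,
`|δ| < π/2`, `0 ≤ γ ≤ π/2`, `cos γ = c`, `sin γ = s'`: the lower test (`0 ≤ a`, `0 ≤ m c − |n| s'`,
`a²Y² ≤ (m c − |n| s')²`) gives `a ≤ cos ξ`, and either `1 ≤ b` or the narrow test (`0 ≤ c`, `0 ≤ b`,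
`m² ≤ c²Y²`, `(m c + |n| s')² ≤ b²Y²`) gives `cos ξ ≤ b`, for every `ξ` with `|ξ − δ| ≤ γ`
(`cos(|δ| ± γ) = (m c ∓ |n| s')/Y`, lit-6's `cos_bounds_of_slab`). [folklore] -/
theorem sector_of_tests {δ g Y m n c s' a b : ℝ} (hY : 0 < Y) (hm : Y * Real.cos δ = m)
    (hn : Y * Real.sin δ = n) (hδ : |δ| < π / 2) (hg0 : 0 ≤ g) (hg : g ≤ π / 2)
    (hc : Real.cos g = c) (hs : Real.sin g = s') (ha0 : 0 ≤ a) (hlo0 : 0 ≤ m * c - |n| * s')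
    (hlo : a ^ 2 * Y ^ 2 ≤ (m * c - |n| * s') ^ 2)
    (hup : 1 ≤ b ∨ (0 ≤ c ∧ 0 ≤ b ∧ m ^ 2 ≤ c ^ 2 * Y ^ 2 ∧ (m * c + |n| * s') ^ 2 ≤ b ^ 2 * Y ^ 2)) :
    ∀ ξ, |ξ - δ| ≤ g → a ≤ Real.cos ξ ∧ Real.cos ξ ≤ b := by
  intro ξ hξ
  have hπ : |δ| + g ≤ π := by linarith [abs_nonneg δ]
  have hsa : Real.sin |δ| = |Real.sin δ| := sin_abs_eq_abs_sin (by linarith [abs_nonneg δ])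
  have hYn : Y * |Real.sin δ| = |n| := by rw [← hn, abs_mul, abs_of_pos hY]
  -- `Y cos(|δ| + g) = m c − |n| s'`, `Y cos(|δ| − g) = m c + |n| s'`
  have hplus : Y * Real.cos (|δ| + g) = m * c - |n| * s' := by
    rw [Real.cos_add, Real.cos_abs, hsa, hc, hs, ← hm, ← hYn]; ring
  have hminus : Y * Real.cos (|δ| - g) = m * c + |n| * s' := by
    rw [Real.cos_sub, Real.cos_abs, hsa, hc, hs, ← hm, ← hYn]; ring
  obtain ⟨h1, h2, h3⟩ := cos_bounds_of_slab hπ hξ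
  constructor
  · -- lower bound: `a ≤ cos(|δ| + g) ≤ cos ξ`
    have haY : a * Y ≤ m * c - |n| * s' := by
      have h' : (a * Y) ^ 2 ≤ (m * c - |n| * s') ^ 2 := by rw [mul_pow]; exact hlo
      exact (pow_le_pow_iff_left₀ (mul_nonneg ha0 hY.le) hlo0 two_ne_zero).1 h'
    have : a ≤ Real.cos (|δ| + g) := by
      rw [← hplus] at haY
      exact le_of_mul_le_mul_right (by linarith) hY
    exact this.trans h1
  · rcases hup with hb | ⟨hc0, hb0, hm2, hb2⟩
    · exact h2.trans hb
    · -- narrow window: `g ≤ |δ|` from `cos |δ| ≤ cos g`, then `cos ξ ≤ cos(|δ| − g) ≤ b`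
      have hmle : m ≤ c * Y := by
        rcases le_or_gt m 0 with hm0 | hm0
        · exact hm0.trans (mul_nonneg hc0 hY.le)
        · have h' : m ^ 2 ≤ (c * Y) ^ 2 := by rw [mul_pow]; exact hm2
          exact (pow_le_pow_iff_left₀ hm0.le (mul_nonneg hc0 hY.le) two_ne_zero).1 h'
      have hcosle : Real.cos |δ| ≤ Real.cos g := by
        rw [Real.cos_abs, hc]
        have : Y * Real.cos δ ≤ Y * c := by rw [hm]; linarith
        exact le_of_mul_le_mul_left this hY
      have hgle : g ≤ |δ| := by
        rcases lt_or_ge |δ| g with hlt | hge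
        · have := Real.cos_lt_cos_of_nonneg_of_le_pi (abs_nonneg δ) (by linarith) hlt
          linarith
        · exact hge
      have hbY : m * c + |n| * s' ≤ b * Y := by
        have hL : 0 ≤ m * c + |n| * s' := by
          have : 0 ≤ |n| * s' := mul_nonneg (abs_nonneg _) (by rw [← hs]; exact Real.sin_nonneg_of_nonneg_of_le_pi hg0 (by linarith))
          linarith
        have h' : (m * c + |n| * s') ^ 2 ≤ (b * Y) ^ 2 := by rw [mul_pow]; exact hb2
        exact (pow_le_pow_iff_left₀ hL (mul_nonneg hb0 hY.le) two_ne_zero).1 h'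
      have : Real.cos (|δ| - g) ≤ b := by
        rw [← hminus] at hbY
        exact le_of_mul_le_mul_left (by linarith) hY
      exact (h3 hgle).trans this

/-! ### The channel tests over `ℚ` (one `decide`) and the sector hypothesis `hsec` -/

/-- The per-channel rational tests for the six active channels `(p, q)`, `p ≠ q`, on the typed data:
`m = dirMarginB`, `n = dirSinB`, `Y² = Ysq`, `a = aQ`, `b = bQ`, `c_γ`, `s_γ`. -/
theorem channel_tests : ∀ k : Fin 3 × Fin 3, k.1 ≠ k.2 →
    0 ≤ aQ (finProdFinEquiv k) ∧
    0 ≤ WSCC9.postB_SPdamp.dirMarginB k.1 k.2 * cgQ - |WSCC9.postB_SPdamp.dirSinB k.1 k.2| * sgQ ∧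
    aQ (finProdFinEquiv k) ^ 2 * WSCC9.postB_SPdamp.Ysq k.1 k.2 ≤
      (WSCC9.postB_SPdamp.dirMarginB k.1 k.2 * cgQ - |WSCC9.postB_SPdamp.dirSinB k.1 k.2| * sgQ) ^ 2 ∧
    (1 ≤ bQ (finProdFinEquiv k) ∨
      (0 ≤ cgQ ∧ 0 ≤ bQ (finProdFinEquiv k) ∧
        WSCC9.postB_SPdamp.dirMarginB k.1 k.2 ^ 2 ≤ cgQ ^ 2 * WSCC9.postB_SPdamp.Ysq k.1 k.2 ∧
        (WSCC9.postB_SPdamp.dirMarginB k.1 k.2 * cgQ + |WSCC9.postB_SPdamp.dirSinB k.1 k.2| * sgQ) ^ 2 ≤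
          bQ (finProdFinEquiv k) ^ 2 * WSCC9.postB_SPdamp.Ysq k.1 k.2)) := by
  decide +kernel

/-- **`hsec`** — the per-channel sector hypothesis of lit-6's slab theorem on the window `γ`: active
channels by `sector_of_tests` + `channel_tests`; the three weightless diagonal channels carry the
trivial sector `[−1, 1]`. -/
theorem hsec : ∀ k ξ, |ξ - WSCC9.lurieSystem.δs k| ≤ γ → cert.a k ≤ Real.cos ξ ∧ Real.cos ξ ≤ cert.b k := by
  intro k ξ hξ
  rw [cert_a, cert_b]
  by_cases hk : k.1 = k.2
  · have hab := aQ_bQ_diag k.1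
    have hk' : k = (k.1, k.1) := by ext <;> simp [hk]
    have ha : a k = -1 := by
      unfold a aK eκ; rw [hk']; exact_mod_cast hab.1
    have hb : b k = 1 := by
      unfold b bK eκ; rw [hk']; exact_mod_cast hab.2
    rw [ha, hb]
    exact ⟨Real.neg_one_le_cos ξ, Real.cos_le_one ξ⟩
  · obtain ⟨ha0, hlo0, hlo, hup⟩ := channel_tests k hk
    have hE := WSCC9.postB_SPdamp_eqData
    have hBq : 0 < WSCC9.postB_SPdamp.B k.1 k.2 := WSCC9.postB_SPdamp_B_pos k.1 k.2 hk
    have hB : 0 < WSCC9.postB_SPdamp.toModel.B k.1 k.2 := WSCC9.postB_SPdamp.toModel_B_pos WSCC9.postB_SPdamp_B_pos k.1 k.2 hk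
    have hY : 0 < WSCC9.postB_SPdamp.toModel.Ypol k.1 k.2 := WSCC9.postB_SPdamp.toModel.Ypol_pos hB
    have hm : WSCC9.postB_SPdamp.toModel.Ypol k.1 k.2 *
        Real.cos (WSCC9.postB_SPdamp.angleOf k.1 - WSCC9.postB_SPdamp.angleOf k.2 + WSCC9.postB_SPdamp.toModel.θpol k.1 k.2)
          = ((WSCC9.postB_SPdamp.dirMarginB k.1 k.2 : ℚ) : ℝ) := by
      rw [WSCC9.postB_SPdamp.toModel.Ypol_mul_cos_add hB, WSCC9.postB_SPdamp.dirMarginB_cast hE]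
    have hn : WSCC9.postB_SPdamp.toModel.Ypol k.1 k.2 *
        Real.sin (WSCC9.postB_SPdamp.angleOf k.1 - WSCC9.postB_SPdamp.angleOf k.2 + WSCC9.postB_SPdamp.toModel.θpol k.1 k.2)
          = ((WSCC9.postB_SPdamp.dirSinB k.1 k.2 : ℚ) : ℝ) := by
      rw [WSCC9.postB_SPdamp.toModel.Ypol_mul_sin_add hB, WSCC9.postB_SPdamp.dirSinB_cast hE]
    have hδ := WSCC9.postB_SPdamp_channelShift_abs_lt k
    have hY2 : WSCC9.postB_SPdamp.toModel.Ypol k.1 k.2 ^ 2 = ((WSCC9.postB_SPdamp.Ysq k.1 k.2 : ℚ) : ℝ) :=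
      WSCC9.postB_SPdamp.Ypol_sq_cast k.1 k.2
    have hδs : WSCC9.lurieSystem.δs k
        = WSCC9.postB_SPdamp.angleOf k.1 - WSCC9.postB_SPdamp.angleOf k.2 + WSCC9.postB_SPdamp.toModel.θpol k.1 k.2 := rfl
    rw [hδs] at hξ
    refine sector_of_tests (a := a k) (b := b k) hY hm hn hδ γ_range.1 γ_range.2 cos_γ sin_γ ?_ ?_ ?_ ?_ ξ hξ
    · unfold a aK eκ; exact_mod_cast ha0
    · exact_mod_cast hlo0
    · unfold a aK eκ; rw [mul_comm, ← mul_comm (((aQ _ : ℚ) : ℝ) ^ 2), hY2]; exact_mod_cast hlo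
    · rcases hup with h1 | ⟨h2, h3, h4, h5⟩
      · left; unfold b bK eκ; exact_mod_cast h1
      · right
        refine ⟨by exact_mod_cast h2, by unfold b bK eκ; exact_mod_cast h3, ?_, ?_⟩
        · rw [hY2]; exact_mod_cast h4
        · unfold b bK eκ; rw [hY2]; exact_mod_cast h5

/-! ### The rank-one level -/

/-- **`hlev`**: `c < γ²/s_k` on every channel (from the decided test `c·s_k < γ_lo²` and `γ_lo < γ`). -/
theorem hlev : ∀ k, ((cQ : ℚ) : ℝ) < γ ^ 2 / s k := by
  intro k
  rw [lt_div_iff₀ (s_pos k)]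
  have h1 : ((cQ : ℚ) : ℝ) * s k < ((gammaLoQ : ℚ) : ℝ) ^ 2 := by
    unfold s; exact_mod_cast level_test (eκ k)
  have h0 : (0 : ℝ) ≤ ((gammaLoQ : ℚ) : ℝ) := by exact_mod_cast gammaLo_test.1
  have h2 : ((gammaLoQ : ℚ) : ℝ) ^ 2 < γ ^ 2 := pow_lt_pow_left₀ gammaLo_lt_γ h0 two_ne_zero
  exact h1.trans h2

/-! ### THE SENTENCE -/

/-- **#35 «G2.c-WSCC9-LOSSY-SLAB» (lane V) — THE CERTIFIED REGION OF THE PRINTED-LOSSY WSCC9 CLASSICAL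
MODEL, HYPOTHESIS-FREE EXCEPT FOR THE INITIAL DATA.** MODEL M′ = `WSCC9.postB_SPdamp.toModel` (WSCC9
post-fault-B classical model, Kron reduction WITH transfer conductances as printed h12, printed damping
`D/M = 1/10, 1/5, 3/10`), read in Pai's directed Lur'e presentation `WSCC9.lurieSystem`; CLASS C′ = the
slab + Popov certificate `WSCC9LossySlab.cert` (sos-2 Λ `2541e15e`, vertex route). STATEMENT: for every
solution `c` of M′ on `univ` whose Lur'e state `x = (ω | σ − σ*)` starts in the slab
`|σ_k − δ*_k| < γ = 2·arctan(13/200)` (all nine directed channels) with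
`V(x(0)) ≤ c = 176462957398167/222684717500000000`: the slab and the level are kept for all `t ≥ 0`
and `x(t) → 0` — every speed deviation `→ 0` and every relative rotor angle `δ_{a+1} − δ_0 →` its
post-fault equilibrium value. Printed BESIDE #24: on the SAME object the Popov-free quadratic class is
empty (`WSCC9LurieObstruction`). No sentence here says a grid is stable.
[cite: Pai1981, §2.16 Theorem [18] eqs. (2.63)–(2.64) and §4.7.3 eqs. (4.115)–(4.117); VuTuritsyn2017, §4.3 Theorem 1 with eq. (V_min); BoydVandenberghe2004, §2.3.2 Example 2.10] -/
theorem lossy_slab_roa {c : ℝ → ClassicalSwing.State 3}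
    (hc : WSCC9.postB_SPdamp.toModel.IsSolutionOn c univ)
    (h0 : WSCC9.postB_SPdamp.lurieState WSCC9.postB_SPdamp.angleOf (c 0) ∈ WSCC9.lurieSystem.slab (fun _ => γ))
    (h0c : cert.V (WSCC9.postB_SPdamp.lurieState WSCC9.postB_SPdamp.angleOf (c 0)) ≤ ((cQ : ℚ) : ℝ)) :
    (∀ t, 0 ≤ t →
        WSCC9.postB_SPdamp.lurieState WSCC9.postB_SPdamp.angleOf (c t) ∈ WSCC9.lurieSystem.slab (fun _ => γ) ∧
          cert.V (WSCC9.postB_SPdamp.lurieState WSCC9.postB_SPdamp.angleOf (c t)) ≤ ((cQ : ℚ) : ℝ)) ∧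
      Tendsto (fun t => WSCC9.postB_SPdamp.lurieState WSCC9.postB_SPdamp.angleOf (c t)) atTop (𝓝 0) := by
  have key := cert.well_subset_regionOfAttraction_of_rankOne (γ := fun _ => γ) hsec s_pos rankOne hlev h0 h0c
  exact key.2 (fun t => WSCC9.postB_SPdamp.lurieState WSCC9.postB_SPdamp.angleOf (c t)) rfl
    fun T t ht => WSCC9.hasDerivWithinAt_lurieState hc t

end Summit.Ventures.GridStability.Lyapunov.WSCC9LossySlab

end
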